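import Summits.CriticalPhenomena.PercolationContinuityZ3.Theorems.PercNearOneGluingNoHeavyLowerTailSunflowerC1FastKernel
import Summits.CriticalPhenomena.PercolationContinuityZ3.Theorems.PercNearOneGluingNoHeavyLowerTailSunflowerC1SplittingCertificate
import HarnessLib

/-!
# `NoHeavyLowerTail` (crux stmt-CriticalPhenomena-4575), abstract sunflower cubic at LAW level: the FAST (C1) CERTIFICATE
# (`checkFast`: cell tables → `AG`, `LA`, `LB` by table products → canonical Gladkov splitting → two fast region certificates)

Support file (seat `prim-ineq-gen-2` gen 33; `--supports stmt-CriticalPhenomena-4575`).  No `sorry`, no computation in this file.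
Memo: run/shared/lean/prim/prim-ineq-gen-2/GLADKOV-SPLITTING-GEN33.md §1–§3.

Same certificate as `checkSplit` (…SunflowerC1SplittingCertificate) computed with the table kernel (…SunflowerC1FastKernel), plus the
EMPTY-PETAL SHORTCUT: a structure with an empty petal has `e₃ ≡ 0`, so (C1) only needs `AG ≽ 0`, which is re-certified directly.
* `cellTabs`, `agE3`, `laLbAg` (tables; `eval_laLbAg_one/two/ag`), `certSideTW` + `eval_nonneg_of_certSideTW`;
* heuristic part (never trusted): `subADW`, `labTab`, `subCountW`, `canonTabW`, `splitTW`;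
* `checkSplitTW`, `checkFast` and **`c1_of_checkFast`**: `checkFast (mkTabs n) F = true ⟹` (C1) for `F` at every bias `x ∈ [0,1]^n`.
Cost ≈ 60 ms per 4-coin structure (compiled), against ≈ 1.6 s for `checkSplit`.
-/

namespace Summit.CriticalPhenomena.PercolationContinuityZ3.Theorems.SunflowerPartition

namespace SafeCalc

namespace C1Cert

open Finset Bern

variable {n : ℕ}

/-! ## FAST (C1) CHECK: cell tables, `AG`, `LA`, `LB` via `mulTW`, region certificates via `certifyTW` -/

section Pipeline

variable (tb : Tabs n) (F : Sunflower (Fin n))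

/-- The five cell tables `(b, c₁, c₂, c₃, a)`. [this work] -/
def cellTabs : Array (Array ℤ) := #[cellA F 0, cellA F 1, cellA F 2, cellA F 3, cellA F 4]

/-- Tables of `AG = ab − (c₁c₂ + c₁c₃ + c₂c₃)` (degree `2`) and `c₁c₂c₃` (degree `3`) from the cell tables. [this work] -/
def agE3 (C : Array (Array ℤ)) : Array ℤ × Array ℤ :=
  let b := C.getD 0 #[]
  let c1 := C.getD 1 #[]
  let c2 := C.getD 2 #[]
  let c3 := C.getD 3 #[]
  let a := C.getD 4 #[]
  let c12 := mulTW n 1 1 tb.st11 c1 c2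
  (tabulate (ofTable n 2 (mulTW n 1 1 tb.st11 a b) - ofTable n 2 c12 - ofTable n 2 (mulTW n 1 1 tb.st11 c1 c3)
      - ofTable n 2 (mulTW n 1 1 tb.st11 c2 c3)),
    mulTW n 2 1 tb.st21 c12 c3)

/-- Tables of `LA = a·AG − c₁c₂c₃` and `LB = b·AG − c₁c₂c₃` (degree `3`) and of `AG`, from the cell tables `C`. [this work] -/
def laLbAg (C : Array (Array ℤ)) : Array ℤ × Array ℤ × Array ℤ :=
  let P := agE3 tb C
  (tabulate (ofTable n 3 (mulTW n 2 1 tb.st21 P.1 (C.getD 4 #[])) - ofTable n 3 P.2),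
    tabulate (ofTable n 3 (mulTW n 2 1 tb.st21 P.1 (C.getD 0 #[])) - ofTable n 3 P.2),
    P.1)

/-- Evaluation of the fast `LA` table. [this work] -/
theorem eval_laLbAg_one (x : Fin n → ℝ) :
    eval (ofTable n 3 (laLbAg (mkTabs n) (cellTabs F)).1) x =
      cellMass F 4 x * (cellMass F 4 x * cellMass F 0 x
        - (cellMass F 1 x * cellMass F 2 x + cellMass F 1 x * cellMass F 3 x + cellMass F 2 x * cellMass F 3 x))
      - cellMass F 1 x * cellMass F 2 x * cellMass F 3 x := by
  have h21 : ∀ A B : Array ℤ, eval (ofTable n 3 (mulTW n 2 1 (subTab n 2 1) A B)) x =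
      eval (ofTable n 2 A) x * eval (ofTable n 1 B) x := fun A B => eval_mulTW (a := 2) (b := 1) A B x
  have h11 : ∀ A B : Array ℤ, eval (ofTable n 2 (mulTW n 1 1 (subTab n 1 1) A B)) x =
      eval (ofTable n 1 A) x * eval (ofTable n 1 B) x := fun A B => eval_mulTW (a := 1) (b := 1) A B x
  simp only [laLbAg, agE3, cellTabs, mkTabs, ofTable_tabulate, eval_sub, h21, h11]
  simp only [show (#[cellA F 0, cellA F 1, cellA F 2, cellA F 3, cellA F 4] : Array (Array ℤ)).getD 0 #[] = cellA F 0 from rfl,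
    show (#[cellA F 0, cellA F 1, cellA F 2, cellA F 3, cellA F 4] : Array (Array ℤ)).getD 1 #[] = cellA F 1 from rfl,
    show (#[cellA F 0, cellA F 1, cellA F 2, cellA F 3, cellA F 4] : Array (Array ℤ)).getD 2 #[] = cellA F 2 from rfl,
    show (#[cellA F 0, cellA F 1, cellA F 2, cellA F 3, cellA F 4] : Array (Array ℤ)).getD 3 #[] = cellA F 3 from rfl,
    show (#[cellA F 0, cellA F 1, cellA F 2, cellA F 3, cellA F 4] : Array (Array ℤ)).getD 4 #[] = cellA F 4 from rfl,
    eval_cellA]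
  ring

/-- Evaluation of the fast `LB` table. [this work] -/
theorem eval_laLbAg_two (x : Fin n → ℝ) :
    eval (ofTable n 3 (laLbAg (mkTabs n) (cellTabs F)).2.1) x =
      cellMass F 0 x * (cellMass F 4 x * cellMass F 0 x
        - (cellMass F 1 x * cellMass F 2 x + cellMass F 1 x * cellMass F 3 x + cellMass F 2 x * cellMass F 3 x))
      - cellMass F 1 x * cellMass F 2 x * cellMass F 3 x := by
  have h21 : ∀ A B : Array ℤ, eval (ofTable n 3 (mulTW n 2 1 (subTab n 2 1) A B)) x =
      eval (ofTable n 2 A) x * eval (ofTable n 1 B) x := fun A B => eval_mulTW (a := 2) (b := 1) A B x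
  have h11 : ∀ A B : Array ℤ, eval (ofTable n 2 (mulTW n 1 1 (subTab n 1 1) A B)) x =
      eval (ofTable n 1 A) x * eval (ofTable n 1 B) x := fun A B => eval_mulTW (a := 1) (b := 1) A B x
  simp only [laLbAg, agE3, cellTabs, mkTabs, ofTable_tabulate, eval_sub, h21, h11]
  simp only [show (#[cellA F 0, cellA F 1, cellA F 2, cellA F 3, cellA F 4] : Array (Array ℤ)).getD 0 #[] = cellA F 0 from rfl,
    show (#[cellA F 0, cellA F 1, cellA F 2, cellA F 3, cellA F 4] : Array (Array ℤ)).getD 1 #[] = cellA F 1 from rfl,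
    show (#[cellA F 0, cellA F 1, cellA F 2, cellA F 3, cellA F 4] : Array (Array ℤ)).getD 2 #[] = cellA F 2 from rfl,
    show (#[cellA F 0, cellA F 1, cellA F 2, cellA F 3, cellA F 4] : Array (Array ℤ)).getD 3 #[] = cellA F 3 from rfl,
    show (#[cellA F 0, cellA F 1, cellA F 2, cellA F 3, cellA F 4] : Array (Array ℤ)).getD 4 #[] = cellA F 4 from rfl,
    eval_cellA]
  ring

/-- Evaluation of the fast `AG` table. [this work] -/
theorem eval_laLbAg_ag (x : Fin n → ℝ) :
    eval (ofTable n 2 (laLbAg (mkTabs n) (cellTabs F)).2.2) x =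
      cellMass F 4 x * cellMass F 0 x
        - (cellMass F 1 x * cellMass F 2 x + cellMass F 1 x * cellMass F 3 x + cellMass F 2 x * cellMass F 3 x) := by
  have h11 : ∀ A B : Array ℤ, eval (ofTable n 2 (mulTW n 1 1 (subTab n 1 1) A B)) x =
      eval (ofTable n 1 A) x * eval (ofTable n 1 B) x := fun A B => eval_mulTW (a := 1) (b := 1) A B x
  simp only [laLbAg, agE3, cellTabs, mkTabs, ofTable_tabulate, eval_sub, h11]
  simp only [show (#[cellA F 0, cellA F 1, cellA F 2, cellA F 3, cellA F 4] : Array (Array ℤ)).getD 0 #[] = cellA F 0 from rfl,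
    show (#[cellA F 0, cellA F 1, cellA F 2, cellA F 3, cellA F 4] : Array (Array ℤ)).getD 1 #[] = cellA F 1 from rfl,
    show (#[cellA F 0, cellA F 1, cellA F 2, cellA F 3, cellA F 4] : Array (Array ℤ)).getD 2 #[] = cellA F 2 from rfl,
    show (#[cellA F 0, cellA F 1, cellA F 2, cellA F 3, cellA F 4] : Array (Array ℤ)).getD 3 #[] = cellA F 3 from rfl,
    show (#[cellA F 0, cellA F 1, cellA F 2, cellA F 3, cellA F 4] : Array (Array ℤ)).getD 4 #[] = cellA F 4 from rfl,
    eval_cellA]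
  ring

/-- A table vanishes on the indices `< N`. [this work] -/
def isZeroOn (N : ℕ) (X : Array ℤ) : Bool := (List.range N).all fun i => X.getD i 0 == 0

/-- A multi-affine table vanishing on its box evaluates to `0`. [this work] -/
theorem eval_eq_zero_of_isZeroOn {X : Array ℤ} (h : isZeroOn (2 ^ n) X = true) (x : Fin n → ℝ) : eval (ofTable n 1 X) x = 0 := by
  simp only [isZeroOn, List.all_eq_true, List.mem_range, beq_iff_eq] at h
  unfold eval
  refine sum_eq_zero fun e _ => ?_
  have := h _ (encode_lt n e)
  simp only [ofTable, this, Int.cast_zero, zero_mul]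

/-- Some petal of `F` is empty (its cell table vanishes). [this work] -/
def hasEmptyPetal : Bool :=
  isZeroOn (2 ^ n) (cellA F 1) || (isZeroOn (2 ^ n) (cellA F 2) || isZeroOn (2 ^ n) (cellA F 3))

/-- With an empty petal, `c₁c₂c₃ = 0` at every bias. [this work] -/
theorem e3_eq_zero_of_hasEmptyPetal (h : hasEmptyPetal F = true) (x : Fin n → ℝ) :
    cellMass F 1 x * cellMass F 2 x * cellMass F 3 x = 0 := by
  simp only [hasEmptyPetal, Bool.or_eq_true] at h
  rcases h with h | h | h
  · rw [← eval_cellA F 1, eval_eq_zero_of_isZeroOn h]; ring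
  · rw [← eval_cellA F 2, eval_eq_zero_of_isZeroOn h]; ring
  · rw [← eval_cellA F 3, eval_eq_zero_of_isZeroOn h]; ring

end Pipeline

/-- **Fast Bernstein region certificate** for a degree-`3` table `T` on `{D ≥ 0}` (`D` multi-affine): `S₁` (degree `2`), `S₂`
(degree `1`) and `N·T − D·S₁ − D²·S₂` pass `certifyTW`. [this work] -/
def certSideTW (n : ℕ) (tb : Tabs n) (T D : Array ℤ) (N : ℕ) (S₁ S₂ : Array ℤ) : Bool :=
  let s1d : Array ℤ := mulTW n 2 1 tb.st21 S₁ D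
  let dd : Array ℤ := mulTW n 1 1 tb.st11 D D
  let s2dd : Array ℤ := mulTW n 2 1 tb.st21 dd S₂
  let s0 : Array ℤ := tabulate ((N : ℤ) • ofTable n 3 T - ofTable n 3 s1d - ofTable n 3 s2dd)
  decide (0 < N) && (certifyTW n 2 tb.al2 S₁ && (certifyTW n 1 tb.al1 S₂ && certifyTW n 3 tb.al3 s0))

/-- **Soundness of the fast region certificate**: on the cube, `D(x) ≥ 0 ⟹ T(x) ≥ 0`. [this work] -/
theorem eval_nonneg_of_certSideTW {T D S₁ S₂ : Array ℤ} {N : ℕ} (h : certSideTW n (mkTabs n) T D N S₁ S₂ = true)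
    {x : Fin n → ℝ} (hx : ∀ i, 0 ≤ x i ∧ x i ≤ 1) (hD : 0 ≤ eval (ofTable n 1 D) x) : 0 ≤ eval (ofTable n 3 T) x := by
  simp only [certSideTW, mkTabs, Bool.and_eq_true, decide_eq_true_eq] at h
  obtain ⟨hN, h1, h2, h0⟩ := h
  have e1 := eval_nonneg_of_certifyTW h1 hx
  have e2 := eval_nonneg_of_certifyTW h2 hx
  have e0 := eval_nonneg_of_certifyTW h0 hx
  have h21 : ∀ A B : Array ℤ, eval (ofTable n 3 (mulTW n 2 1 (subTab n 2 1) A B)) x =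
      eval (ofTable n 2 A) x * eval (ofTable n 1 B) x := fun A B => eval_mulTW (a := 2) (b := 1) A B x
  have h11 : ∀ A B : Array ℤ, eval (ofTable n 2 (mulTW n 1 1 (subTab n 1 1) A B)) x =
      eval (ofTable n 1 A) x * eval (ofTable n 1 B) x := fun A B => eval_mulTW (a := 1) (b := 1) A B x
  rw [ofTable_tabulate, eval_sub, eval_sub, eval_smul, h21, h21, h11] at e0
  have hN' : (0 : ℝ) < (N : ℤ) := by exact_mod_cast hN
  have key : 0 ≤ ((N : ℤ) : ℝ) * eval (ofTable n 3 T) x := by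
    nlinarith [mul_nonneg e1 hD, mul_nonneg (mul_nonneg hD hD) e2]
  exact (mul_nonneg_iff_of_pos_left hN').mp key

/-! ## The canonical splitting, fast heuristic part (PROPOSES `S₁`; never trusted) -/

/-- Sub-cube additive domination read off a Bernstein table. [this work] -/
def subADW (n : ℕ) (ct : Array (Array Bool)) (TB : Array ℤ) (b : ℕ) : Bool :=
  let row := ct.getD b #[]
  (List.range (4 ^ n)).all fun a => !row.getD a false || decide (0 ≤ TB.getD a 0)

/-- Labels of the points, indexed by the degree-`1` code of their indicator vector. [this work] -/
def labTab (F : Sunflower (Fin n)) : Array (Fin 5) :=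
  Array.ofFn fun p : Fin (2 ^ n) =>
    let e : Expo n 1 := decode n p
    F.lab (univ.filter fun i => (e i : ℕ) = 1)

/-- Number of points of the sub-cube of the 2-fibre index `b` with label `ℓ` (fast). [this work] -/
def subCountW (n : ℕ) (pt : Array (Array Bool)) (LT : Array (Fin 5)) (b : ℕ) (ℓ : Fin 5) : ℕ :=
  let row := pt.getD b #[]
  ((List.range (2 ^ n)).filter fun p => row.getD p false && LT.getD p 0 == ℓ).length

/-- The canonical colouring as a TABLE over the 2-fibre indices (heuristic; B-fibre = `true`). [this work] -/
def canonTabW (n : ℕ) (tb : Tabs n) (LT : Array (Fin 5)) (laB lbB : Array ℤ) : Array Bool :=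
  Array.ofFn fun b : Fin (3 ^ n) =>
    let adA := subADW n tb.ct laB b
    let adB := subADW n tb.ct lbB b
    if adB && !adA then true
    else if adA then false
    else decide (subCountW n tb.pt LT b 0 < subCountW n tb.pt LT b 4)

/-- Monomial table of `AG` restricted to the fibres selected by `sel` (fast backward transform of the masked `g`). [this work] -/
def splitTW (n : ℕ) (tb : Tabs n) (g : Array ℤ) (sel : ℕ → Bool) : Array ℤ :=
  backTW n 2 tb.al2 (List.finRange n) (Array.ofFn fun b : Fin (3 ^ n) => if sel b then g.getD b 0 else 0)

/-- **The fast data-free (C1) check** (the certificate of `checkSplit`, table arithmetic with shared index tables). [this work] -/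
def checkSplitTW (tb : Tabs n) (F : Sunflower (Fin n)) : Bool :=
  let L := laLbAg tb (cellTabs F)
  let laB := fwdTW n 3 tb.al3 L.1
  let lbB := fwdTW n 3 tb.al3 L.2.1
  let g := fwdTW n 2 tb.al2 L.2.2
  let inB := canonTabW n tb (labTab F) laB lbB
  let s1A := splitTW n tb g fun b => inB.getD b false
  let s1B := splitTW n tb g fun b => !inB.getD b false
  certSideTW n tb L.1 (dArr F) 1 s1A (zeroArr n 1) && certSideTW n tb L.2.1 (ndArr F) 1 s1B (zeroArr n 1)

/-- **(C1) from the fast check**: if `checkSplitTW (mkTabs n) F = true` then `e₃(c) ≤ max(a,b)·(ab − e₂(c))` at every bias.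
[this work] -/
theorem c1_of_checkSplitTW (F : Sunflower (Fin n)) (h : checkSplitTW (mkTabs n) F = true) (x : Fin n → ℝ)
    (hx : ∀ i, 0 ≤ x i ∧ x i ≤ 1) :
    cellMass F 1 x * cellMass F 2 x * cellMass F 3 x ≤
      max (cellMass F 4 x) (cellMass F 0 x) *
        (cellMass F 4 x * cellMass F 0 x
          - (cellMass F 1 x * cellMass F 2 x + cellMass F 1 x * cellMass F 3 x + cellMass F 2 x * cellMass F 3 x)) := by
  simp only [checkSplitTW, Bool.and_eq_true] at h
  obtain ⟨hA, hB⟩ := h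
  rcases le_total (cellMass F 0 x) (cellMass F 4 x) with hab | hba
  · rw [max_eq_left hab]
    have hD : 0 ≤ eval (ofTable n 1 (dArr F)) x := by rw [eval_dArr]; linarith
    have h := eval_nonneg_of_certSideTW hA hx hD
    rw [eval_laLbAg_one] at h
    linarith
  · rw [max_eq_right hba]
    have hD : 0 ≤ eval (ofTable n 1 (ndArr F)) x := by rw [eval_ndArr]; linarith
    have h := eval_nonneg_of_certSideTW hB hx hD
    rw [eval_laLbAg_two] at h
    linarith

/-- **The fast (C1) check with the empty-petal shortcut**: a structure with an empty petal only needs `AG ≽ 0` (which always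
holds — antipodal Gladkov — and is re-certified here); otherwise the canonical splitting check. [this work] -/
def checkFast (tb : Tabs n) (F : Sunflower (Fin n)) : Bool :=
  if hasEmptyPetal F then certifyTW n 2 tb.al2 (laLbAg tb (cellTabs F)).2.2 else checkSplitTW tb F

/-- **(C1) from the fast check with shortcut.** [this work] -/
theorem c1_of_checkFast (F : Sunflower (Fin n)) (h : checkFast (mkTabs n) F = true) (x : Fin n → ℝ)
    (hx : ∀ i, 0 ≤ x i ∧ x i ≤ 1) :
    cellMass F 1 x * cellMass F 2 x * cellMass F 3 x ≤
      max (cellMass F 4 x) (cellMass F 0 x) *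
        (cellMass F 4 x * cellMass F 0 x
          - (cellMass F 1 x * cellMass F 2 x + cellMass F 1 x * cellMass F 3 x + cellMass F 2 x * cellMass F 3 x)) := by
  unfold checkFast at h
  by_cases he : hasEmptyPetal F = true
  · rw [if_pos he] at h
    have hag := eval_nonneg_of_certifyTW h hx
    rw [eval_laLbAg_ag] at hag
    rw [e3_eq_zero_of_hasEmptyPetal F he x]
    exact mul_nonneg (le_max_of_le_left (cellMass_nonneg F 4 hx)) hag
  · rw [if_neg he] at h
    exact c1_of_checkSplitTW F h x hx

end C1Cert

end SafeCalc

end Summit.CriticalPhenomena.PercolationContinuityZ3.Theorems.SunflowerPartition
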